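import Mathlib
import Summits.AtomisticToContinuum.FouriersLaw.Theorems.ParityLiouvilleSeedCesaroUpgradeGrowth
import HarnessLib

/-!
# Cesàro upgrade, helper 6: the site energy of the pinned chain and the continuity equation

Support file for item `stmt-AtomisticToContinuum-13981` (`ParityLiouvilleSeed.CesaroUpgrade`).

For the pinned chain `pinnedChain ω₂ lam β γ` (any real parameters) and a site `x`, the site
energy `e_x = p_x²/2 + U(q_x) + ½[V(q_{x+1} - q_x) + V(q_x - q_{x-1})]` is a `C¹` local
function on the box `{x-1, x, x+1}` (`contDiff_siteEnergyProfile`,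
`siteEnergy_eq_comp_boxRestrictAt`); its six partial derivatives along the box coordinates are
computed (`partial_siteEnergy`, one-variable calculus along coordinate lines), and the
**continuity equation** `𝒜e_x = j_{x-1} - j_x` follows from the box formula for the Liouville
operator (`liouvilleZ_siteEnergy_eq`). No definitions (the profile is written out).
-/

noncomputable section

namespace Summit.AtomisticToContinuum.FouriersLaw.Theorems.CesaroUpgrade

open MeasureTheory Filter Topology Set
open Literature.MathematicalPhysics.KineticTheory.HeatConduction

section PinnedChain

variable (ω₂ lam β γ : ℝ)

/-! ### The site energy and the continuity equation `𝒜e_x = j_{x-1} - j_x` -/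

/-- `U` of the pinned chain is differentiable with `U'(q) = ω₂ q + lam q³`. [folklore] -/
theorem hasDerivAt_pinnedChain_U (q : ℝ) :
    HasDerivAt (pinnedChain ω₂ lam β γ).U (ω₂ * q + lam * q ^ 3) q := by
  have h1 : HasDerivAt (fun q : ℝ => q ^ 2) (2 * q) q := by simpa using hasDerivAt_pow 2 q
  have h2 : HasDerivAt (fun q : ℝ => q ^ 4) (4 * q ^ 3) q := by simpa using hasDerivAt_pow 4 q
  have h : HasDerivAt (fun q : ℝ => ω₂ * q ^ 2 / 2 + lam * q ^ 4 / 4)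
      (ω₂ * (2 * q) / 2 + lam * (4 * q ^ 3) / 4) q :=
    ((h1.const_mul ω₂).div_const 2).add ((h2.const_mul lam).div_const 4)
  rw [show (pinnedChain ω₂ lam β γ).U = fun q => ω₂ * q ^ 2 / 2 + lam * q ^ 4 / 4 from rfl]
  exact h.congr_deriv (by ring)

/-- `V` of the pinned chain is differentiable with `V'(r) = r + β r³`. [folklore] -/
theorem hasDerivAt_pinnedChain_V (r : ℝ) :
    HasDerivAt (pinnedChain ω₂ lam β γ).V (r + β * r ^ 3) r := by
  have h1 : HasDerivAt (fun r : ℝ => r ^ 2) (2 * r) r := by simpa using hasDerivAt_pow 2 r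
  have h2 : HasDerivAt (fun r : ℝ => r ^ 4) (4 * r ^ 3) r := by simpa using hasDerivAt_pow 4 r
  have h : HasDerivAt (fun r : ℝ => r ^ 2 / 2 + β * r ^ 4 / 4)
      (2 * r / 2 + β * (4 * r ^ 3) / 4) r :=
    (h1.div_const 2).add ((h2.const_mul β).div_const 4)
  rw [show (pinnedChain ω₂ lam β γ).V = fun r => r ^ 2 / 2 + β * r ^ 4 / 4 from rfl]
  exact h.congr_deriv (by ring)

/-- The site-energy profile `e(y) = p₁²/2 + U(q₁) + ½[V(q₂ - q₁) + V(q₁ - q₀)]` on the box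
`{x-1, x, x+1}` is `C¹`. [folklore] -/
theorem contDiff_siteEnergyProfile :
    ContDiff ℝ 1 fun y : Fin (2 + 1) → ℝ × ℝ =>
      (y 1).2 ^ 2 / 2 + (pinnedChain ω₂ lam β γ).U (y 1).1 +
        ((pinnedChain ω₂ lam β γ).V ((y 2).1 - (y 1).1) +
          (pinnedChain ω₂ lam β γ).V ((y 1).1 - (y 0).1)) / 2 := by
  have hU : ContDiff ℝ 1 (pinnedChain ω₂ lam β γ).U := by
    rw [show (pinnedChain ω₂ lam β γ).U = fun q => ω₂ * q ^ 2 / 2 + lam * q ^ 4 / 4 from rfl]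
    fun_prop
  have hV : ContDiff ℝ 1 (pinnedChain ω₂ lam β γ).V := by
    rw [show (pinnedChain ω₂ lam β γ).V = fun r => r ^ 2 / 2 + β * r ^ 4 / 4 from rfl]
    fun_prop
  fun_prop

/-- The site energy `e_x` written on the infinite configuration equals its box profile composed
with the box restriction to `{x-1, x, x+1}`. [folklore] -/
theorem siteEnergy_eq_comp_boxRestrictAt (x : ℤ) :
    (fun σ : ChainConfig => (σ x).2 ^ 2 / 2 + (pinnedChain ω₂ lam β γ).U (σ x).1 +
      ((pinnedChain ω₂ lam β γ).V ((σ (x + 1)).1 - (σ x).1) +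
        (pinnedChain ω₂ lam β γ).V ((σ x).1 - (σ (x - 1)).1)) / 2) =
    (fun y : Fin (2 + 1) → ℝ × ℝ =>
      (y 1).2 ^ 2 / 2 + (pinnedChain ω₂ lam β γ).U (y 1).1 +
        ((pinnedChain ω₂ lam β γ).V ((y 2).1 - (y 1).1) +
          (pinnedChain ω₂ lam β γ).V ((y 1).1 - (y 0).1)) / 2) ∘ boxRestrictAt (x - 1) 2 := by
  funext σ
  have e0 : x - 1 + ((((0 : Fin (2 + 1)) : ℕ) : ℤ)) = x - 1 := by simp
  have e1 : x - 1 + ((((1 : Fin (2 + 1)) : ℕ) : ℤ)) = x := by simp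
  have e2 : x - 1 + ((((2 : Fin (2 + 1)) : ℕ) : ℤ)) = x + 1 := by
    simp only [Fin.val_two, Nat.cast_ofNat]; ring
  simp only [Function.comp_apply, boxRestrictAt_apply, e0, e1, e2]

/-- **Partial derivatives of the site energy** `e_x` (as a local function on the box
`{x-1, x, x+1}`) along the coordinates `q_{x-1}, p_{x-1}, q_x, p_x, q_{x+1}, p_{x+1}`. [folklore] -/
theorem partial_siteEnergy (x : ℤ) (σ : ChainConfig) :
    let P := pinnedChain ω₂ lam β γ
    let F : ChainConfig → ℝ := (fun y : Fin (2 + 1) → ℝ × ℝ =>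
      (y 1).2 ^ 2 / 2 + P.U (y 1).1 + (P.V ((y 2).1 - (y 1).1) + P.V ((y 1).1 - (y 0).1)) / 2) ∘
        boxRestrictAt (x - 1) 2
    partialQZ (x - 1) F σ = -deriv P.V ((σ x).1 - (σ (x - 1)).1) / 2 ∧
      partialPZ (x - 1) F σ = 0 ∧
      partialQZ x F σ = deriv P.U (σ x).1 - deriv P.V ((σ (x + 1)).1 - (σ x).1) / 2 +
          deriv P.V ((σ x).1 - (σ (x - 1)).1) / 2 ∧
      partialPZ x F σ = (σ x).2 ∧
      partialQZ (x + 1) F σ = deriv P.V ((σ (x + 1)).1 - (σ x).1) / 2 ∧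
      partialPZ (x + 1) F σ = 0 := by
  intro P F
  have heZ := siteEnergy_eq_comp_boxRestrictAt ω₂ lam β γ x
  have hx3 : x ≠ x - 1 := by omega
  have hx4 : x + 1 ≠ x - 1 := by omega
  have hx5 : x - 1 ≠ x + 1 := by omega
  have hUd : ∀ t, HasDerivAt P.U (deriv P.U t) t := fun t =>
    (hasDerivAt_pinnedChain_U ω₂ lam β γ t).differentiableAt.hasDerivAt
  have hVd : ∀ t, HasDerivAt P.V (deriv P.V t) t := fun t =>
    (hasDerivAt_pinnedChain_V ω₂ lam β γ t).differentiableAt.hasDerivAt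
  simp only [F, P]
  rw [← heZ]
  simp only [partialQZ, partialPZ]
  refine ⟨?_, ?_, ?_, ?_, ?_, ?_⟩
  · -- ∂_{q_{x-1}}
    have hfun : (fun t : ℝ => (Function.update σ (x - 1) (t, (σ (x - 1)).2) x).2 ^ 2 / 2 +
        P.U (Function.update σ (x - 1) (t, (σ (x - 1)).2) x).1 +
        (P.V ((Function.update σ (x - 1) (t, (σ (x - 1)).2) (x + 1)).1 -
            (Function.update σ (x - 1) (t, (σ (x - 1)).2) x).1) +
          P.V ((Function.update σ (x - 1) (t, (σ (x - 1)).2) x).1 -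
            (Function.update σ (x - 1) (t, (σ (x - 1)).2) (x - 1)).1)) / 2) =
        fun t => (σ x).2 ^ 2 / 2 + P.U (σ x).1 +
          (P.V ((σ (x + 1)).1 - (σ x).1) + P.V ((σ x).1 - t)) / 2 := by
      funext t
      simp [Function.update_self, Function.update_of_ne hx3, Function.update_of_ne hx4]
    rw [hfun]
    have h : HasDerivAt (fun t => (σ x).2 ^ 2 / 2 + P.U (σ x).1 +
        (P.V ((σ (x + 1)).1 - (σ x).1) + P.V ((σ x).1 - t)) / 2)
        (0 + (0 + deriv P.V ((σ x).1 - (σ (x - 1)).1) * (-1)) / 2) (σ (x - 1)).1 := by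
      refine (hasDerivAt_const _ _).add (((hasDerivAt_const _ _).add ?_).div_const 2)
      exact (hVd _).comp _ ((hasDerivAt_id _).const_sub _)
    rw [h.deriv]; ring
  · -- ∂_{p_{x-1}}
    have hfun : (fun t : ℝ => (Function.update σ (x - 1) ((σ (x - 1)).1, t) x).2 ^ 2 / 2 +
        P.U (Function.update σ (x - 1) ((σ (x - 1)).1, t) x).1 +
        (P.V ((Function.update σ (x - 1) ((σ (x - 1)).1, t) (x + 1)).1 -
            (Function.update σ (x - 1) ((σ (x - 1)).1, t) x).1) +
          P.V ((Function.update σ (x - 1) ((σ (x - 1)).1, t) x).1 -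
            (Function.update σ (x - 1) ((σ (x - 1)).1, t) (x - 1)).1)) / 2) =
        fun _ => (σ x).2 ^ 2 / 2 + P.U (σ x).1 +
          (P.V ((σ (x + 1)).1 - (σ x).1) + P.V ((σ x).1 - (σ (x - 1)).1)) / 2 := by
      funext t
      simp [Function.update_self, Function.update_of_ne hx3, Function.update_of_ne hx4]
    rw [hfun, deriv_const]
  · -- ∂_{q_x}
    have hfun : (fun t : ℝ => (Function.update σ x (t, (σ x).2) x).2 ^ 2 / 2 +
        P.U (Function.update σ x (t, (σ x).2) x).1 +
        (P.V ((Function.update σ x (t, (σ x).2) (x + 1)).1 - (Function.update σ x (t, (σ x).2) x).1) +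
          P.V ((Function.update σ x (t, (σ x).2) x).1 -
            (Function.update σ x (t, (σ x).2) (x - 1)).1)) / 2) =
        fun t => (σ x).2 ^ 2 / 2 + P.U t +
          (P.V ((σ (x + 1)).1 - t) + P.V (t - (σ (x - 1)).1)) / 2 := by
      funext t
      simp [Function.update_self]
    rw [hfun]
    have h : HasDerivAt (fun t => (σ x).2 ^ 2 / 2 + P.U t +
        (P.V ((σ (x + 1)).1 - t) + P.V (t - (σ (x - 1)).1)) / 2)
        (0 + deriv P.U (σ x).1 + (deriv P.V ((σ (x + 1)).1 - (σ x).1) * (-1) +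
          deriv P.V ((σ x).1 - (σ (x - 1)).1) * 1) / 2) (σ x).1 := by
      refine ((hasDerivAt_const _ _).add (hUd _)).add ((HasDerivAt.add ?_ ?_).div_const 2)
      · exact (hVd _).comp _ ((hasDerivAt_id _).const_sub _)
      · exact (hVd _).comp _ ((hasDerivAt_id _).sub_const _)
    rw [h.deriv]; ring
  · -- ∂_{p_x}
    have hfun : (fun t : ℝ => (Function.update σ x ((σ x).1, t) x).2 ^ 2 / 2 +
        P.U (Function.update σ x ((σ x).1, t) x).1 +
        (P.V ((Function.update σ x ((σ x).1, t) (x + 1)).1 - (Function.update σ x ((σ x).1, t) x).1) +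
          P.V ((Function.update σ x ((σ x).1, t) x).1 -
            (Function.update σ x ((σ x).1, t) (x - 1)).1)) / 2) =
        fun t => t ^ 2 / 2 + (P.U (σ x).1 +
          (P.V ((σ (x + 1)).1 - (σ x).1) + P.V ((σ x).1 - (σ (x - 1)).1)) / 2) := by
      funext t
      simp [Function.update_self]
      ring
    rw [hfun]
    have h : HasDerivAt (fun t => t ^ 2 / 2 + (P.U (σ x).1 +
        (P.V ((σ (x + 1)).1 - (σ x).1) + P.V ((σ x).1 - (σ (x - 1)).1)) / 2))
        (2 * (σ x).2 / 2 + 0) (σ x).2 := by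
      refine (HasDerivAt.div_const ?_ 2).add (hasDerivAt_const _ _)
      simpa using hasDerivAt_pow 2 (σ x).2
    rw [h.deriv]; ring
  · -- ∂_{q_{x+1}}
    have hfun : (fun t : ℝ => (Function.update σ (x + 1) (t, (σ (x + 1)).2) x).2 ^ 2 / 2 +
        P.U (Function.update σ (x + 1) (t, (σ (x + 1)).2) x).1 +
        (P.V ((Function.update σ (x + 1) (t, (σ (x + 1)).2) (x + 1)).1 -
            (Function.update σ (x + 1) (t, (σ (x + 1)).2) x).1) +
          P.V ((Function.update σ (x + 1) (t, (σ (x + 1)).2) x).1 -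
            (Function.update σ (x + 1) (t, (σ (x + 1)).2) (x - 1)).1)) / 2) =
        fun t => (σ x).2 ^ 2 / 2 + P.U (σ x).1 +
          (P.V (t - (σ x).1) + P.V ((σ x).1 - (σ (x - 1)).1)) / 2 := by
      funext t
      simp [Function.update_self, Function.update_of_ne hx5]
    rw [hfun]
    have h : HasDerivAt (fun t => (σ x).2 ^ 2 / 2 + P.U (σ x).1 +
        (P.V (t - (σ x).1) + P.V ((σ x).1 - (σ (x - 1)).1)) / 2)
        (0 + (deriv P.V ((σ (x + 1)).1 - (σ x).1) * 1 + 0) / 2) (σ (x + 1)).1 := by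
      refine (hasDerivAt_const _ _).add ((HasDerivAt.add ?_ (hasDerivAt_const _ _)).div_const 2)
      exact (hVd _).comp _ ((hasDerivAt_id _).sub_const _)
    rw [h.deriv]; ring
  · -- ∂_{p_{x+1}}
    have hfun : (fun t : ℝ => (Function.update σ (x + 1) ((σ (x + 1)).1, t) x).2 ^ 2 / 2 +
        P.U (Function.update σ (x + 1) ((σ (x + 1)).1, t) x).1 +
        (P.V ((Function.update σ (x + 1) ((σ (x + 1)).1, t) (x + 1)).1 -
            (Function.update σ (x + 1) ((σ (x + 1)).1, t) x).1) +
          P.V ((Function.update σ (x + 1) ((σ (x + 1)).1, t) x).1 -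
            (Function.update σ (x + 1) ((σ (x + 1)).1, t) (x - 1)).1)) / 2) =
        fun _ => (σ x).2 ^ 2 / 2 + P.U (σ x).1 +
          (P.V ((σ (x + 1)).1 - (σ x).1) + P.V ((σ x).1 - (σ (x - 1)).1)) / 2 := by
      funext t
      simp [Function.update_self, Function.update_of_ne hx5]
    rw [hfun, deriv_const]


/-- **The continuity equation** `𝒜e_x = j_{x-1} - j_x` for the site energy
`e_x = p_x²/2 + U(q_x) + ½[V(q_{x+1} - q_x) + V(q_x - q_{x-1})]` of the pinned chain (box form).
[folklore] -/
theorem liouvilleZ_siteEnergy_eq (x : ℤ) (σ : ChainConfig) :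
    liouvilleZ (pinnedChain ω₂ lam β γ) ((fun y : Fin (2 + 1) → ℝ × ℝ =>
      (y 1).2 ^ 2 / 2 + (pinnedChain ω₂ lam β γ).U (y 1).1 +
        ((pinnedChain ω₂ lam β γ).V ((y 2).1 - (y 1).1) +
          (pinnedChain ω₂ lam β γ).V ((y 1).1 - (y 0).1)) / 2) ∘ boxRestrictAt (x - 1) 2) σ =
      (pinnedChain ω₂ lam β γ).bondCurrentZ σ (x - 1) - (pinnedChain ω₂ lam β γ).bondCurrentZ σ x := by
  obtain ⟨p0q, p0p, p1q, p1p, p2q, p2p⟩ := partial_siteEnergy ω₂ lam β γ x σ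
  have hdiff := (contDiff_siteEnergyProfile ω₂ lam β γ).differentiable one_ne_zero
  have e0 : x - 1 + ((((0 : Fin (2 + 1)) : ℕ) : ℤ)) = x - 1 := by simp
  have e1 : x - 1 + ((((1 : Fin (2 + 1)) : ℕ) : ℤ)) = x := by simp
  have e2 : x - 1 + ((((2 : Fin (2 + 1)) : ℕ) : ℤ)) = x + 1 := by
    simp only [Fin.val_two, Nat.cast_ofNat]; ring
  have h0q := partialQZ_comp_boxRestrictAt_of_eq (x - 1) 2 σ 0 (hdiff _)
  have h0p := partialPZ_comp_boxRestrictAt_of_eq (x - 1) 2 σ 0 (hdiff _)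
  have h1q := partialQZ_comp_boxRestrictAt_of_eq (x - 1) 2 σ 1 (hdiff _)
  have h1p := partialPZ_comp_boxRestrictAt_of_eq (x - 1) 2 σ 1 (hdiff _)
  have h2q := partialQZ_comp_boxRestrictAt_of_eq (x - 1) 2 σ 2 (hdiff _)
  have h2p := partialPZ_comp_boxRestrictAt_of_eq (x - 1) 2 σ 2 (hdiff _)
  rw [e0] at h0q h0p
  rw [e1] at h1q h1p
  rw [e2] at h2q h2p
  rw [p0q] at h0q
  rw [p0p] at h0p
  rw [p1q] at h1q
  rw [p1p] at h1p
  rw [p2q] at h2q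
  rw [p2p] at h2p
  rw [liouvilleZ_comp_boxRestrictAt _ (x - 1) 2 σ (hdiff _)]
  simp only [Fin.sum_univ_succ, Fin.sum_univ_zero, Fin.succ_zero_eq_one, Fin.succ_one_eq_two,
    add_zero]
  rw [← h0q, ← h0p, ← h1q, ← h1p, ← h2q, ← h2p, e0, e1, e2]
  have e3 : x - 1 + 1 = x := by ring
  simp only [OscillatorChain.force_eq, OscillatorChain.bondCurrentZ, e3]
  ring

end PinnedChain

end Summit.AtomisticToContinuum.FouriersLaw.Theorems.CesaroUpgrade

end
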